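import Literature.NumberTheory.PAdicHodge.TateTraceKernel
import Literature.NumberTheory.PAdicHodge.TateEigenvectorCoefficients
import Literature.NumberTheory.PAdicHodge.TateSenCocycles
import Mathlib.FieldTheory.Galois.Profinite
import Mathlib.Topology.Algebra.Module.FiniteDimension
import Mathlib.Analysis.Normed.Group.Submodule
import HarnessLib

/-!
# Finite vectors of `\widehat{K_∞}` under `G₀` lie in `K_∞` (Sen's lemma, scalar case, base tower)

Literature port (statements and proofs). Setting of `TateInvariantsBase`: `F/ℚ_p` finite,
`K₀ = PadicBase F p hp ≅ ℚ_p ⊆ F`, `F̄ = NormedAlgClosure F`, `ℂ_F = CompletedAlgClosure F`,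
`G₀ = Gal(F̄/K₀) = BaseGaloisGroup hp`, the cyclotomic tower `K m = K₀(ζ_{p^m})`, `K_∞ = ⋃ K m`,
`S = K_∞ ⊆ ℂ_F`, `X = \widehat{K_∞}` its closure, `H = Gal(F̄/K_∞) = {g | ∀ M, g ζ_{p^M} = ζ_{p^M}}`,
Tate's normalised traces `R_n = Rhat n : X → K n` and the generator `γ_n = gen n` of `Gal(K_∞/K n)`.

## Main results

* `TateTrace.isClosed_image_K` — the image of the layer `K n` in `ℂ_F` is closed (a
  finite-dimensional `K₀`-subspace of `F̄`, complete since `K₀` is complete, mapped isometrically).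
* `TateTrace.Rhat_mem_image_K` — `R_n x ∈ K n` for every `x ∈ X` (density).
* `TateTrace.mem_image_K_of_gen_smul_eq` — **`X^{γ_n} = K n`**: an element of `X = \widehat{K_∞}` fixed
  by `γ_n` lies in `K n` (Tate's estimate `‖x - R_n x‖ ≤ ‖p‖⁻² ‖γ_n x - x‖`).
* `TateTrace.exists_mem_image_K_of_orbit_subset_span` — ★ **Sen's finite-vector lemma over the base
  tower (scalar case)**: if `x ∈ X` and the `G₀`-orbit of `x` lies in the `K₀`-span of finitely many
  elements of `ℂ_F`, then `x ∈ K n` for some `n`; `TateTrace.mem_S_of_orbit_subset_span` — hence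
  `x ∈ K_∞`. This is the case `W = ℂ_F` (trivial representation) of the statement "the `K_∞`-vector
  space of `H`-invariant `Γ`-finite vectors of `\widehat{K_∞} ⊗ W` is `D_Sen(W)`, of dimension
  `dim W` over `K_∞`", i.e. `(\widehat{K_∞})^{Γ-fin} = K_∞`.

## Proof sketch (Sen, via Tate)

Let `V` be the `K₀`-span of the orbit `G₀ • x`: finite-dimensional, `G₀`-stable, contained in `X`,
hence fixed pointwise by `H` (Ax–Sen–Tate, `fixedPoints_eq_X`). Continuity of the orbit maps
`g ↦ g • b` (`b` running through a basis of `V`; `TateSen.continuous_base_smul_left`), equivalence of norms on the finite-dimensional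
`K₀`-space `V` (`LinearMap.toContinuousLinearMap`) and compactness of `G₀` (the closed stabilisers
of the `ζ_{p^m}` decrease to `H`) give a level `m₀` with `‖g v - v‖ ≤ ‖p‖³ ‖v‖` for all `v ∈ V` and
all `g` fixing `ζ_{p^{m₀}}`; in particular for `g = γ_n`, `n = max m₀ 2`. For `v ∈ V` the vector
`w = γ_n v - v ∈ V ∩ X` has `R_n w = 0` (`Rhat_gen_smul_sub_self`), so Tate's estimate gives
`‖w‖ ≤ ‖p‖⁻² ‖γ_n w - w‖ ≤ ‖p‖ ‖w‖`, i.e. `w = 0`. Thus `γ_n x = x`, and `x = R_n x ∈ K n`.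

## References

* S. Sen, *Continuous cohomology and p-adic Galois representations*, Invent. Math. 62 (1980)
  (original source of the decompletion; not consulted, acq-06291). [Sen1980]
* O. Brinon, B. Conrad, *CMI Summer School notes on p-adic Hodge theory* (2009), Thm. 15.1.2 and
  Thm. 15.1.5 (Sen's theory of decompletion; here the case of the trivial representation). [BrinonConrad2009]
* J. Tate, *p-divisible groups* (1967), §3.1–§3.2, Prop. 7. [Tate1967]
* J.-M. Fontaine, Y. Ouyang, *Theory of p-adic Galois representations*, §3.1–§3.2. [FontaineOuyang2022]
-/

noncomputable section

open ValuativeRel Field UniformSpace Filter Topology Finset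

open scoped IntermediateField

namespace Literature.NumberTheory.PAdicHodge

open Literature.NumberTheory.GaloisRepresentations
open Literature.NumberTheory.GaloisRepresentations.IsNonarchimedeanLocalField
open CyclotomicTower

variable {F : Type} [Field F] [ValuativeRel F] [TopologicalSpace F] [IsNonarchimedeanLocalField F]
  [CharZero F] {p : ℕ} [Fact p.Prime] (hp : valuation F p < 1)

namespace TateTrace

/-! ### The layers `K n ⊆ ℂ_F` are closed -/

/-- The image of `K n` in `ℂ_F` lies in `S = K_∞`. [folklore] -/
private theorem image_K_subset_S (n : ℕ) :
    ((↑) : NormedAlgClosure F → CompletedAlgClosure F) '' (K hp n : Set (NormedAlgClosure F)) ⊆ S hp := by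
  rintro _ ⟨y, hy, rfl⟩
  exact coe_mem_S hp (K_le_Kinf hp n hy)

/-- **The layer `K n ⊆ F̄` is complete**: a finite-dimensional normed `K₀`-space (`‖c • z‖ = ‖c‖ ‖z‖`)
over the complete field `K₀ ≅ ℚ_p` (Mathlib `FiniteDimensional.complete`; cf. the tree's
`TateTameStructure.isClosed_of_finiteDimensional`). [cite: SerreLocalFields1979, Ch. II §1 Prop. 1] -/
theorem isComplete_coe_K (n : ℕ) : IsComplete (K hp n : Set (NormedAlgClosure F)) := by
  letI : NormedSpace (PadicBase F p hp) (K hp n) := ⟨fun c z => by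
    change ‖((c • z : K hp n) : NormedAlgClosure F)‖ ≤ ‖c‖ * ‖(z : NormedAlgClosure F)‖
    rw [IntermediateField.coe_smul, norm_smul_base]⟩
  haveI : FiniteDimensional (PadicBase F p hp) (K hp n) := by
    rw [K_def]
    exact IntermediateField.adjoin.finiteDimensional
      (Algebra.IsAlgebraic.isAlgebraic (zeta F p n)).isIntegral
  haveI : CompleteSpace (K hp n) := FiniteDimensional.complete (PadicBase F p hp) (K hp n)
  exact completeSpace_coe_iff_isComplete.mp (by infer_instance)

/-- **The layer `K n` is closed in `ℂ_F`** (complete, hence its isometric image in the completion is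
complete and closed). [cite: SerreLocalFields1979, Ch. II §1 Prop. 1] -/
theorem isClosed_image_K (n : ℕ) :
    IsClosed (((↑) : NormedAlgClosure F → CompletedAlgClosure F) '' (K hp n : Set (NormedAlgClosure F))) :=
  ((Completion.isUniformInducing_coe (α := NormedAlgClosure F)).isComplete_iff.mpr
    (isComplete_coe_K hp n)).isClosed

/-! ### `R_n` takes values in `K n`, and `X^{γ_n} = K n` -/

/-- **`R_n x ∈ K n` for every `x ∈ X = \widehat{K_∞}`** (on `S` by `traceToLevel_mem_K`, on `X` by
density since `K n ⊆ ℂ_F` is closed). [cite: Tate1967, §3.1] [cite: FontaineOuyang2022, §3.1] -/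
theorem Rhat_mem_image_K {n : ℕ} (hn : 2 ≤ n) (x : X hp) :
    Rhat hp n x ∈ ((↑) : NormedAlgClosure F → CompletedAlgClosure F) '' (K hp n : Set (NormedAlgClosure F)) := by
  refine isClosed_property (denseRange_incl hp)
    (p := fun x => Rhat hp n x ∈ ((↑) : NormedAlgClosure F → CompletedAlgClosure F) '' (K hp n : Set (NormedAlgClosure F)))
    ((isClosed_image_K hp n).preimage (continuous_Rhat hp hn)) (fun s => ?_) x
  rw [Rhat_incl hp hn]
  obtain ⟨hl, hmem⟩ := lvl_spec hp n s
  exact ⟨_, traceToLevel_mem_K hp hn hl hmem, rfl⟩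

/-- **`X^{γ_n} = K n`**: an element of `X = \widehat{K_∞}` fixed by `γ_n = gen n` (`n ≥ 2`) lies in
`K n` — by Tate's estimate `‖x - R_n x‖ ≤ ‖p‖⁻² ‖γ_n x - x‖ = 0`, so `x = R_n x ∈ K n`.
[cite: Tate1967, §3.2 Prop. 7] [cite: FontaineOuyang2022, §3.1] -/
theorem mem_image_K_of_gen_smul_eq {n : ℕ} (hn : 2 ≤ n) {x : CompletedAlgClosure F} (hx : x ∈ X hp)
    (hγ : gen hp n • x = x) :
    x ∈ ((↑) : NormedAlgClosure F → CompletedAlgClosure F) '' (K hp n : Set (NormedAlgClosure F)) := by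
  have hest := norm_sub_Rhat_le hp hn ⟨x, hx⟩
  have h0 : ‖x - Rhat hp n ⟨x, hx⟩‖ ≤ 0 := by
    refine hest.trans (le_of_eq ?_)
    change _ * ‖gen hp n • x - x‖ = 0
    rw [hγ, sub_self, norm_zero, mul_zero]
  have h1 : x = Rhat hp n ⟨x, hx⟩ := sub_eq_zero.mp (norm_le_zero_iff.mp h0)
  rw [h1]
  exact Rhat_mem_image_K hp hn ⟨x, hx⟩

/-- `X^{γ_n} ⊆ K_∞`: an element of `X` fixed by some `γ_n` (`n ≥ 2`) lies in `S = K_∞`. [cite: Tate1967, §3.2 Prop. 7] -/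
theorem mem_S_of_gen_smul_eq {n : ℕ} (hn : 2 ≤ n) {x : CompletedAlgClosure F} (hx : x ∈ X hp)
    (hγ : gen hp n • x = x) : x ∈ S hp :=
  image_K_subset_S hp n (mem_image_K_of_gen_smul_eq hp hn hx hγ)

/-! ### `H` fixes `X`; stabilisers of the `ζ_{p^m}` shrink to `H` -/

/-- Every `g ∈ H = Gal(F̄/K_∞)` (i.e. fixing all `ζ_{p^M}`) fixes `X = \widehat{K_∞}` pointwise
(Ax–Sen–Tate, `fixedPoints_eq_X`). [cite: Tate1967, §3.3 Theorem 1] -/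
theorem smul_eq_self_of_forall_smul_zeta_eq {x : CompletedAlgClosure F} (hx : x ∈ X hp)
    (g : BaseGaloisGroup hp) (hg : ∀ M, g • zeta F p M = zeta F p M) : g • x = x := by
  rw [← fixedPoints_eq_X hp] at hx
  exact hx g hg

/-- `γ_n` is small on stabilisers: the stabilisers `{g | g ζ_{p^m} = ζ_{p^m}}` of the `ζ_{p^m}` in the
compact group `G₀` are closed and decrease to `H`; hence every open set containing `H` contains one of
them (Cantor intersection, Mathlib `exists_subset_nhds_of_isCompact'`). [folklore] -/
private theorem exists_stabilizer_zeta_subset {U : Set (BaseGaloisGroup hp)} (hU : IsOpen U)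
    (hHU : ∀ g : BaseGaloisGroup hp, (∀ M, g • zeta F p M = zeta F p M) → g ∈ U) :
    ∃ m₀ : ℕ, ∀ g : BaseGaloisGroup hp, g • zeta F p m₀ = zeta F p m₀ → g ∈ U := by
  haveI : IsGalois (PadicBase F p hp) (NormedAlgClosure F) := inferInstance
  let St : ℕ → Set (BaseGaloisGroup hp) := fun m =>
    (MulAction.stabilizer (BaseGaloisGroup hp) (zeta F p m) : Set (BaseGaloisGroup hp))
  have hSt : ∀ m (g : BaseGaloisGroup hp), g ∈ St m ↔ g • zeta F p m = zeta F p m := fun m g =>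
    MulAction.mem_stabilizer_iff
  have hclosed : ∀ m, IsClosed (St m) := fun m =>
    (MulAction.stabilizer (BaseGaloisGroup hp) (zeta F p m)).isClosed_of_isOpen
      (stabilizer_isOpen_of_isIntegral (K := PadicBase F p hp) (L := NormedAlgClosure F) (zeta F p m))
  have hcpt : ∀ m, IsCompact (St m) := fun m => (hclosed m).isCompact
  have hdir : Directed (· ⊇ ·) St := by
    refine directed_of_isDirected_le fun m m' hmm' => ?_
    intro g hg
    obtain ⟨i, hi⟩ := exists_zeta_eq_pow (F := F) (p := p) hmm'
    rw [hSt] at hg ⊢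
    rw [hi, smul_pow', hg]
  have hnhds : ∀ g ∈ ⋂ m, St m, U ∈ 𝓝 g := by
    intro g hg
    refine hU.mem_nhds (hHU g fun M => ?_)
    exact (hSt M g).mp (Set.mem_iInter.mp hg M)
  obtain ⟨m₀, hm₀⟩ := exists_subset_nhds_of_isCompact' hdir hcpt hclosed hnhds
  exact ⟨m₀, fun g hg => hm₀ ((hSt m₀ g).mpr hg)⟩

/-! ### The `K₀`-vector space structure of `ℂ_F` -/

/-- The scalar multiplication of `K₀` on `F̄` is uniformly continuous (it is multiplication by
`algebraMap K₀ F̄ c`); this makes Mathlib's `K₀`-module structure on the completion `ℂ_F` available.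
[folklore] -/
private theorem uniformContinuousConstSMul_base :
    UniformContinuousConstSMul (PadicBase F p hp) (NormedAlgClosure F) := by
  refine ⟨fun c => ?_⟩
  have h : (fun x : NormedAlgClosure F => c • x) =
      fun x => algebraMap (PadicBase F p hp) (NormedAlgClosure F) c • x :=
    funext fun x => by rw [smul_eq_mul, Algebra.smul_def]
  rw [h]
  exact uniformContinuous_const_smul _

/-- **The scalar action of `K₀` on `ℂ_F` is multiplication by `ι`**: Mathlib's action of `K₀` on the
completion `ℂ_F = \\widehat{F̄}` (extending `c • y`, `y ∈ F̄`, by continuity) is `c • v = ι(c) v`.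
[folklore] -/
private theorem base_scalar_smul_eq_ι_mul (c : PadicBase F p hp) (v : CompletedAlgClosure F) :
    c • v = ι hp c * v := by
  haveI := uniformContinuousConstSMul_base hp
  induction v using Completion.induction_on with
  | hp => exact isClosed_eq (continuous_const_smul c) (continuous_const.mul continuous_id)
  | ih y => rw [← Completion.coe_smul, coe_base_smul]

/-- `‖c • v‖ = ‖c‖ ‖v‖` for `c ∈ K₀`, `v ∈ ℂ_F`. [folklore] -/
private theorem norm_base_scalar_smul (c : PadicBase F p hp) (v : CompletedAlgClosure F) :
    ‖c • v‖ = ‖c‖ * ‖v‖ := by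
  rw [base_scalar_smul_eq_ι_mul, norm_mul, norm_ι]

/-- `G₀` commutes with the scalars of `K₀` on `ℂ_F`. [folklore] -/
private theorem base_smul_scalar_smul (g : BaseGaloisGroup hp) (c : PadicBase F p hp) (v : CompletedAlgClosure F) :
    g • (c • v) = c • g • v := by
  rw [base_scalar_smul_eq_ι_mul, base_scalar_smul_eq_ι_mul, smul_mul', base_smul_ι]

/-! ### ★ Sen's finite-vector lemma over the base tower (scalar case) -/

/-- ★ **Sen's lemma (scalar case, base tower): the `G₀`-finite vectors of `X = \widehat{K_∞}` lie in
the layers `K n`.** Let `x ∈ X` and suppose the `G₀`-orbit of `x` lies in the `K₀`-span of finitely many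
elements `b₀, …, b_{d-1} ∈ ℂ_F` (`g • x = Σ_i ι(c_i) b_i`). Then `γ_n • x = x` and `x ∈ K n` for some
`n ≥ 2`. (Proof: the `K₀`-span `V` of the orbit is finite-dimensional, `G₀`-stable, `⊆ X`, fixed by `H`;
by compactness and norm equivalence some `γ_n` satisfies `‖γ_n v - v‖ ≤ ‖p‖³ ‖v‖` on `V`; for `v ∈ V`,
`w = γ_n v - v ∈ V ∩ ker R_n` and Tate's estimate `‖w‖ ≤ ‖p‖⁻² ‖γ_n w - w‖ ≤ ‖p‖ ‖w‖` forces `w = 0`.)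
[cite: BrinonConrad2009, Thm. 15.1.2 and Thm. 15.1.5 (case of the trivial representation)]
[cite: Sen1980, original source (not consulted, acq-06291)] [cite: Tate1967, §3.2 Prop. 7] -/
theorem exists_mem_image_K_of_orbit_subset_span {x : CompletedAlgClosure F} (hx : x ∈ X hp) {d : ℕ}
    (b : Fin d → CompletedAlgClosure F)
    (horb : ∀ g : BaseGaloisGroup hp, ∃ c : Fin d → PadicBase F p hp,
      g • x = ∑ i, ι hp (c i) * b i) :
    ∃ n, 2 ≤ n ∧ gen hp n • x = x ∧
      x ∈ ((↑) : NormedAlgClosure F → CompletedAlgClosure F) '' (K hp n : Set (NormedAlgClosure F)) := by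
  classical
  have hpP : p.Prime := Fact.out
  -- the `K₀`-vector space structure of `ℂ_F` (Mathlib's completion of the normed `K₀`-space `F̄`;
  -- the scalars act through `ι : K₀ → ℂ_F`)
  haveI := uniformContinuousConstSMul_base hp
  letI : NormedSpace (PadicBase F p hp) (CompletedAlgClosure F) :=
    @NormedSpace.mk (PadicBase F p hp) (CompletedAlgClosure F) _ _ inferInstance
      (fun c v => (norm_base_scalar_smul hp c v).le)
  have hsmul : ∀ (c : PadicBase F p hp) (v : CompletedAlgClosure F), c • v = ι hp c * v :=
    base_scalar_smul_eq_ι_mul hp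
  have hcomm : ∀ (g : BaseGaloisGroup hp) (c : PadicBase F p hp) (v : CompletedAlgClosure F),
      g • (c • v) = c • g • v := base_smul_scalar_smul hp
  have hp0 : 0 < ‖(p : PadicBase F p hp)‖ := norm_pos_iff.mpr (Nat.cast_ne_zero.mpr hpP.ne_zero)
  have hp1 : ‖(p : PadicBase F p hp)‖ < 1 := PadicBase.norm_p_lt_one hp
  -- the span `V` of the orbit: finite-dimensional, inside `X`, `G₀`-stable, fixed by `H`
  let V : Submodule (PadicBase F p hp) (CompletedAlgClosure F) :=
    Submodule.span (PadicBase F p hp) (Set.range fun g : BaseGaloisGroup hp => g • x)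
  have hxV : x ∈ V := Submodule.subset_span (Set.mem_range.mpr ⟨1, one_smul _ x⟩)
  have hVle : V ≤ Submodule.span (PadicBase F p hp) (Set.range b) := by
    refine Submodule.span_le.mpr ?_
    rintro _ ⟨g, rfl⟩
    obtain ⟨c, hc⟩ := horb g
    change g • x ∈ Submodule.span (PadicBase F p hp) (Set.range b)
    rw [hc]
    refine Submodule.sum_mem _ fun i _ => ?_
    rw [← hsmul]
    exact Submodule.smul_mem _ _ (Submodule.subset_span ⟨i, rfl⟩)
  haveI : FiniteDimensional (PadicBase F p hp) (Submodule.span (PadicBase F p hp) (Set.range b)) :=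
    FiniteDimensional.span_of_finite _ (Set.finite_range b)
  haveI hVfin : FiniteDimensional (PadicBase F p hp) V := Submodule.finiteDimensional_of_le hVle
  have hVX : ∀ v ∈ V, v ∈ X hp := by
    intro v hv
    induction hv using Submodule.span_induction with
    | mem v hv =>
        obtain ⟨g, rfl⟩ := hv
        exact smul_mem_X hp g hx
    | zero => exact zero_mem_X hp
    | add u w _ _ hu hw => exact add_mem_X hp hu hw
    | smul c v _ hv =>
        rw [hsmul]
        exact ι_mul_mem_X hp c hv
  have hVsm : ∀ (g : BaseGaloisGroup hp), ∀ v ∈ V, g • v ∈ V := by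
    intro g v hv
    induction hv using Submodule.span_induction with
    | mem v hv =>
        obtain ⟨h, rfl⟩ := hv
        exact Submodule.subset_span ⟨g * h, mul_smul g h x⟩
    | zero =>
        rw [smul_zero]
        exact V.zero_mem
    | add u w _ _ hu hw =>
        rw [smul_add]
        exact V.add_mem hu hw
    | smul c v _ hv =>
        rw [hcomm]
        exact V.smul_mem c hv
  have hHV : ∀ v ∈ V, ∀ g : BaseGaloisGroup hp, (∀ M, g • zeta F p M = zeta F p M) → g • v = v :=
    fun v hv g hg => smul_eq_self_of_forall_smul_zeta_eq hp (hVX v hv) g hg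
  -- coordinates with respect to a basis of `V` are bounded (norm equivalence over the complete `K₀`)
  let bV := Module.finBasis (PadicBase F p hp) V
  have hcoord : ∀ i, ∃ A : ℝ, 0 ≤ A ∧ ∀ v : V, ‖bV.repr v i‖ ≤ A * ‖v‖ := by
    intro i
    refine ⟨‖LinearMap.toContinuousLinearMap (bV.coord i)‖, norm_nonneg _, fun v => ?_⟩
    have h := (LinearMap.toContinuousLinearMap (bV.coord i)).le_opNorm v
    rwa [LinearMap.coe_toContinuousLinearMap', Module.Basis.coord_apply] at h
  choose A hA0 hA using hcoord
  -- the smallness threshold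
  have hApos : 0 < ∑ i, A i + 1 := by
    have : 0 ≤ ∑ i, A i := Finset.sum_nonneg fun i _ => hA0 i
    linarith
  let P : ℝ := ‖(p : PadicBase F p hp)‖ ^ 3
  have hP : 0 < P := pow_pos hp0 3
  let δ : ℝ := P / (∑ i, A i + 1)
  have hδ : 0 < δ := div_pos hP hApos
  have hδA : (∑ i, A i) * δ ≤ P := by
    have h1 : (∑ i, A i) * δ ≤ (∑ i, A i + 1) * δ :=
      mul_le_mul_of_nonneg_right (by linarith) hδ.le
    have h2 : (∑ i, A i + 1) * δ = P := by
      change (∑ i, A i + 1) * (P / (∑ i, A i + 1)) = P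
      field_simp
    linarith
  -- the open set `U = {g | ∀ i, ‖g bᵢ - bᵢ‖ < δ} ⊇ H`, and a level `m₀` whose stabiliser lies in `U`
  let U : Set (BaseGaloisGroup hp) :=
    ⋂ i, {g | ‖g • ((bV i : V) : CompletedAlgClosure F) - ((bV i : V) : CompletedAlgClosure F)‖ < δ}
  have hUopen : IsOpen U :=
    isOpen_iInter_of_finite fun i =>
      isOpen_lt (continuous_norm.comp ((TateSen.continuous_base_smul_left hp _).sub continuous_const)) continuous_const
  have hHU : ∀ g : BaseGaloisGroup hp, (∀ M, g • zeta F p M = zeta F p M) → g ∈ U := by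
    intro g hg
    refine Set.mem_iInter.mpr fun i => ?_
    have hfix : g • ((bV i : V) : CompletedAlgClosure F) = ((bV i : V) : CompletedAlgClosure F) :=
      hHV _ (bV i).2 g hg
    change ‖_‖ < δ
    rw [hfix, sub_self, norm_zero]
    exact hδ
  obtain ⟨m₀, hm₀⟩ := exists_stabilizer_zeta_subset hp hUopen hHU
  -- uniform smallness of `g - 1` on `V` for `g` fixing `ζ_{p^{m₀}}`
  have hsmall : ∀ g : BaseGaloisGroup hp, g • zeta F p m₀ = zeta F p m₀ →
      ∀ v ∈ V, ‖g • v - v‖ ≤ P * ‖v‖ := by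
    intro g hg v hv
    have hgU : ∀ i, ‖g • ((bV i : V) : CompletedAlgClosure F) - ((bV i : V) : CompletedAlgClosure F)‖ < δ :=
      fun i => Set.mem_iInter.mp (hm₀ g hg) i
    let v' : V := ⟨v, hv⟩
    have hrepr : v = ∑ i, bV.repr v' i • ((bV i : V) : CompletedAlgClosure F) := by
      have h := congrArg (fun z : V => (z : CompletedAlgClosure F)) (bV.sum_repr v')
      simp only [Submodule.coe_sum, Submodule.coe_smul] at h
      exact h.symm
    have hdiff : g • v - v =
        ∑ i, bV.repr v' i • (g • ((bV i : V) : CompletedAlgClosure F) - ((bV i : V) : CompletedAlgClosure F)) := by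
      conv_lhs => rw [hrepr]
      rw [Finset.smul_sum, ← Finset.sum_sub_distrib]
      refine Finset.sum_congr rfl fun i _ => ?_
      rw [hcomm, smul_sub]
    have hnv : ‖v'‖ = ‖v‖ := rfl
    calc ‖g • v - v‖
        = ‖∑ i, bV.repr v' i •
            (g • ((bV i : V) : CompletedAlgClosure F) - ((bV i : V) : CompletedAlgClosure F))‖ := by
          rw [hdiff]
      _ ≤ ∑ i, ‖bV.repr v' i •
            (g • ((bV i : V) : CompletedAlgClosure F) - ((bV i : V) : CompletedAlgClosure F))‖ :=
          norm_sum_le _ _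
      _ ≤ ∑ i, A i * ‖v‖ * δ := by
          refine Finset.sum_le_sum fun i _ => ?_
          rw [norm_smul]
          have h1 : ‖bV.repr v' i‖ ≤ A i * ‖v‖ := hnv ▸ hA i v'
          exact mul_le_mul h1 (hgU i).le (norm_nonneg _)
            (mul_nonneg (hA0 i) (norm_nonneg _))
      _ = ((∑ i, A i) * δ) * ‖v‖ := by
          rw [Finset.sum_mul, Finset.sum_mul]
          exact Finset.sum_congr rfl fun i _ => by ring
      _ ≤ P * ‖v‖ := mul_le_mul_of_nonneg_right hδA (norm_nonneg _)
  -- the generator `γ_n`, `n = max m₀ 2`, fixes `ζ_{p^{m₀}}`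
  obtain ⟨n, hn2, hnm₀⟩ : ∃ n, 2 ≤ n ∧ m₀ ≤ n := ⟨max m₀ 2, le_max_right _ _, le_max_left _ _⟩
  have hγζ : gen hp n • zeta F p m₀ = zeta F p m₀ := gen_smul_zeta_of_le hp (by omega) hnm₀
  -- every `v ∈ V` is fixed by `γ_n`
  have hfix : ∀ v ∈ V, gen hp n • v = v := by
    intro v hv
    have hwV : gen hp n • v - v ∈ V := V.sub_mem (hVsm _ v hv) hv
    have hwX : gen hp n • v - v ∈ X hp := hVX _ hwV
    have hR : Rhat hp n ⟨gen hp n • v - v, hwX⟩ = 0 := Rhat_gen_smul_sub_self hp hn2 ⟨v, hVX v hv⟩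
    have hest := norm_sub_Rhat_le hp hn2 ⟨gen hp n • v - v, hwX⟩
    rw [hR, sub_zero] at hest
    have h2 := hsmall (gen hp n) hγζ _ hwV
    have hpp : ‖(p : PadicBase F p hp)‖⁻¹ ^ 2 * ‖(p : PadicBase F p hp)‖ ^ 3 =
        ‖(p : PadicBase F p hp)‖ := by
      rw [show ‖(p : PadicBase F p hp)‖ ^ 3 = ‖(p : PadicBase F p hp)‖ ^ 2 * ‖(p : PadicBase F p hp)‖
        from pow_succ _ 2, ← mul_assoc, inv_pow, inv_mul_cancel₀ (pow_ne_zero 2 hp0.ne'), one_mul]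
    have h3 : ‖gen hp n • v - v‖ ≤ ‖(p : PadicBase F p hp)‖ * ‖gen hp n • v - v‖ := by
      refine hest.trans ((mul_le_mul_of_nonneg_left h2 (by positivity)).trans (le_of_eq ?_))
      change ‖(p : PadicBase F p hp)‖⁻¹ ^ 2 * (‖(p : PadicBase F p hp)‖ ^ 3 * ‖gen hp n • v - v‖) = _
      rw [← mul_assoc, hpp]
    have h4 : ‖gen hp n • v - v‖ = 0 := by
      nlinarith [norm_nonneg (gen hp n • v - v), mul_pos (sub_pos.mpr hp1) hp0]
    exact sub_eq_zero.mp (norm_eq_zero.mp h4)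
  exact ⟨n, hn2, hfix x hxV, mem_image_K_of_gen_smul_eq hp hn2 hx (hfix x hxV)⟩

/-- ★ **Sen's lemma (scalar case, base tower), `K_∞`-form: `(\widehat{K_∞})^{G₀-fin} ⊆ K_∞`.** An element
of `X = \widehat{K_∞}` whose `G₀`-orbit spans a finite-dimensional `K₀`-space lies in `S = K_∞`.
[cite: BrinonConrad2009, Thm. 15.1.2 and Thm. 15.1.5 (case of the trivial representation)]
[cite: Sen1980, original source (not consulted, acq-06291)] -/
theorem mem_S_of_orbit_subset_span {x : CompletedAlgClosure F} (hx : x ∈ X hp) {d : ℕ}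
    (b : Fin d → CompletedAlgClosure F)
    (horb : ∀ g : BaseGaloisGroup hp, ∃ c : Fin d → PadicBase F p hp,
      g • x = ∑ i, ι hp (c i) * b i) :
    x ∈ S hp := by
  obtain ⟨n, -, -, hn⟩ := exists_mem_image_K_of_orbit_subset_span hp hx b horb
  exact image_K_subset_S hp n hn

/-- **Converse: elements of `F̄` are `G₀`-finite.** For `y ∈ F̄` the `G₀`-orbit of `↑y ∈ ℂ_F` is
contained in the (finite) image of the root set of the minimal polynomial of `y` over `K₀`, so it lies in
the `K₀`-span of finitely many elements (the inclusion `K_∞ ⊆ (\widehat{K_∞})^{fin}` of Sen's theorem in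
the scalar case). [cite: BrinonConrad2009, Thm. 15.1.2 and Thm. 15.1.5 (case of the trivial representation)] -/
theorem orbit_coe_subset_span (y : NormedAlgClosure F) :
    ∃ (d : ℕ) (b : Fin d → CompletedAlgClosure F), ∀ g : BaseGaloisGroup hp,
      ∃ c : Fin d → PadicBase F p hp, g • (y : CompletedAlgClosure F) = ∑ i, ι hp (c i) * b i := by
  classical
  have hint : IsIntegral (PadicBase F p hp) y := (Algebra.IsAlgebraic.isAlgebraic y).isIntegral
  have hRfin : ((minpoly (PadicBase F p hp) y).rootSet (NormedAlgClosure F)).Finite :=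
    Polynomial.rootSet_finite _ _
  have horbR : ∀ g : BaseGaloisGroup hp,
      g • y ∈ (minpoly (PadicBase F p hp) y).rootSet (NormedAlgClosure F) := by
    intro g
    refine (Polynomial.mem_rootSet_of_ne (minpoly.ne_zero hint)).mpr ?_
    change Polynomial.aeval ((g : NormedAlgClosure F →ₐ[PadicBase F p hp] NormedAlgClosure F) y)
      (minpoly (PadicBase F p hp) y) = 0
    rw [Polynomial.aeval_algHom_apply, minpoly.aeval, map_zero]
  obtain ⟨d, e, he⟩ := hRfin.fin_embedding
  refine ⟨d, fun i => (e i : CompletedAlgClosure F), fun g => ?_⟩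
  obtain ⟨i, hi⟩ : g • y ∈ Set.range e := he ▸ horbR g
  refine ⟨Pi.single i 1, ?_⟩
  rw [CompletedAlgClosure.base_smul_coe, ← hi, Finset.sum_eq_single i]
  · rw [Pi.single_eq_same, ι_def, map_one, map_one, one_mul]
  · intro j _ hj
    rw [Pi.single_eq_of_ne hj, ι_def, map_zero, map_zero, zero_mul]
  · intro h
    exact absurd (Finset.mem_univ i) h

/-- **`K_∞ = (\widehat{K_∞})^{G₀-fin}`**: an element of `ℂ_F` lies in `S = K_∞` iff it lies in
`X = \widehat{K_∞}` and its `G₀`-orbit spans a finite-dimensional `K₀`-space (`→`: every element of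
`F̄` is `G₀`-finite; `←`: Sen's lemma).
[cite: BrinonConrad2009, Thm. 15.1.2 and Thm. 15.1.5 (case of the trivial representation)]
[cite: Sen1980, original source (not consulted, acq-06291)] -/
theorem mem_S_iff_orbit_subset_span {x : CompletedAlgClosure F} :
    x ∈ S hp ↔ x ∈ X hp ∧ ∃ (d : ℕ) (b : Fin d → CompletedAlgClosure F), ∀ g : BaseGaloisGroup hp,
      ∃ c : Fin d → PadicBase F p hp, g • x = ∑ i, ι hp (c i) * b i := by
  constructor
  · intro hx
    refine ⟨S_subset_X hp hx, ?_⟩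
    obtain ⟨y, -, rfl⟩ := (mem_S_iff hp).mp hx
    exact orbit_coe_subset_span hp y
  · rintro ⟨hx, d, b, horb⟩
    exact mem_S_of_orbit_subset_span hp hx b horb

end TateTrace

end Literature.NumberTheory.PAdicHodge
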